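import Literature.Computability.AlgebraicComplexity.CoppersmithWinograd1982ImprovableLambda
import Literature.Computability.AlgebraicComplexity.CoppersmithWinograd1982Crude
import HarnessLib

/-!
# Far-edge descent, kernel XXXII-A: the ISOLATED-ANCHOR step (Knuth Ex. 67(g) with its output structure)

Route `FarEdgeDescent`, special leaf `FiniteSaturation` (stmt-MatrixMultiplication-23739): helper
kernel, THESES-FREE and def-free.  Kernel XXXI proved the analytic half of Pan's IMPROVABLE squaring
tower (order `log(4/3)/log(3/2) = 0.70951…`) as an interface theorem and recorded that iterating
improvability through tensor squares "needs a Literature definition of improvable approximate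
realisations".  It does not: the class is carried here as an INLINE invariant on an approximate
decomposition `(u_s, v_s, w_s)_{s<r}` of a tensor `t` (tree order of factors: outputs, `X`-inputs,
`Y`-inputs) together with weights `d_s ∈ K[ε]`,

  `(∀ s, d_s ≠ 0) ∧ ∀ b c, ¬(b ∈ A_X ∧ c ∈ A_Y) → ∑_s d_s v_s(b) w_s(c) = 0`        (ISOLATED ANCHOR)

for anchor predicates `A_X, A_Y` marking the inputs of one inner-product block `⟨1,Q,1⟩`: the form
`∑_s d_s v_s ⊗ w_s` is supported on the anchor's inputs EXACTLY (no `O(ε)` slack).  This is Stothers'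
"full and isolated" (Stothers 2010, Def. 8) in the shape the tree's 67(g) construction actually OUTPUTS,
and it is stable under the three operations of the tower:

* §1 Kronecker products (`isolated_kronecker`: the weight form factorises,
  `F⊗F'((b,b'),(c,c')) = F(b,c)·F'(b',c')`) and restriction along index maps (`isolated_precomp`).
* §2 `isolated_innerAugment` — Knuth's Ex. 67(g) (tree: `algBorderRank_innerAugment_le_of_improvable`,
  whose construction is repeated verbatim) with the STRUCTURE of its output recorded: the realization
  `(ε^{d₀+e+2} w_s ⊕ d_s) ⊗ (u_s ⊕ ε^{d₀+1} p⁻¹X_{·s}) ⊗ (v_s ⊕ ε^{d₀+1} Y_{·s})` of `t ⊕ ⟨1,q,1⟩` has the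
  SAME weights `d_s` and its weight form vanishes exactly off the new block's inputs (old/old by
  improvability, old/new and new/old by the biorthogonality identities `∑ d u Y = 0`, `∑ d X v = 0`).
* §3 `isolated_reanchor` — the same in the `matMulDirectSum` format: an improvable approximate
  realization of `⊕ᵢ⟨kᵢ,mᵢ,nᵢ⟩` of length `r` yields one of `⟨1,q,1⟩ ⊕ ⊕ᵢ⟨kᵢ,mᵢ,nᵢ⟩`
  (`q + ∑kᵢmᵢ + ∑mᵢnᵢ ≤ r`) with the anchor (block `0`) ISOLATED.
Kernel XXXII-B squares such a realization and deletes the old anchor; XXXII-C runs the chain from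
Schönhage's `E₃ = ⟨3,1,3⟩ ⊕ ⟨1,4,1⟩` and feeds kernel XXXI-B, making the rate `0.70951…⁻` unconditional.

References: Knuth TAOCP 2, §4.6.4 Ex. 67(c),(g),(h); Stothers 2010, Def. 8, Thm. 8; Pan 1984 (LNCS 179)
§16, Props. 16.2–16.5; Coppersmith–Winograd 1982, Thm. 1.
Tags: `FiniteSaturation` (h₁) NEC · WEAKER (tensor layer of the improvable tower).
-/

set_option linter.dupNamespace false

noncomputable section

open scoped BigOperators Polynomial
open Polynomial

namespace Summit.MatrixMultiplication.MatrixMultiplication.Theorems.FarEdgeDescentIsolatedStep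

open Literature.Computability.AlgebraicComplexity

variable {K : Type} [Field K]

/-! ## §1 The weight form under Kronecker products and index maps -/

/-- The weight form of a Kronecker product of decompositions factorises:
`∑_{(ρ,ρ')} d_ρ d'_{ρ'} · v_ρ(b)v'_{ρ'}(b') · w_ρ(c)w'_{ρ'}(c') = F(b,c) · F'(b',c')`. [folklore] -/
theorem weightSum_kronecker {κ μ κ' μ' : Type*} {r r' : ℕ} (d : Fin r → K[X])
    (v : Fin r → κ → K[X]) (w : Fin r → μ → K[X]) (d' : Fin r' → K[X]) (v' : Fin r' → κ' → K[X])
    (w' : Fin r' → μ' → K[X]) (b : κ × κ') (c : μ × μ') :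
    (∑ ρ : Fin (r * r'), (d (finProdFinEquiv.symm ρ).1 * d' (finProdFinEquiv.symm ρ).2) *
        (v (finProdFinEquiv.symm ρ).1 b.1 * v' (finProdFinEquiv.symm ρ).2 b.2) *
        (w (finProdFinEquiv.symm ρ).1 c.1 * w' (finProdFinEquiv.symm ρ).2 c.2)) =
      (∑ ρ, d ρ * v ρ b.1 * w ρ c.1) * ∑ ρ', d' ρ' * v' ρ' b.2 * w' ρ' c.2 := by
  rw [Finset.sum_mul_sum, ← Fintype.sum_prod_type']
  exact Fintype.sum_equiv finProdFinEquiv.symm _ _ fun ρ => by ring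

/-- **Isolated anchors multiply**: approximate decompositions of `t`, `t'` whose weight forms vanish
off the anchor inputs `A_X × A_Y`, `A'_X × A'_Y` give (by the tree's Kronecker construction,
`IsApproxDecomposition.kronecker`) one of `t ⊗ t'` with weights `d ⊗ d'` (non-zero) whose weight form
vanishes off `(A_X × A'_X) × (A_Y × A'_Y)`. [cite: Stothers2010, §1, Def. 8, Thm. 8]
[cite: Pan1984, Prop. 16.3] -/
theorem isolated_kronecker {ι κ μ ι' κ' μ' : Type*} {h h' r r' : ℕ} {t : ι → κ → μ → K}
    {t' : ι' → κ' → μ' → K} {PX : κ → Prop} {PY : μ → Prop} {PX' : κ' → Prop} {PY' : μ' → Prop}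
    (H : ∃ (u : Fin r → ι → K[X]) (v : Fin r → κ → K[X]) (w : Fin r → μ → K[X]) (d : Fin r → K[X]),
      IsApproxDecomposition h t u v w ∧ (∀ s, d s ≠ 0) ∧
        ∀ b c, ¬ (PX b ∧ PY c) → ∑ s, d s * v s b * w s c = 0)
    (H' : ∃ (u : Fin r' → ι' → K[X]) (v : Fin r' → κ' → K[X]) (w : Fin r' → μ' → K[X])
      (d : Fin r' → K[X]), IsApproxDecomposition h' t' u v w ∧ (∀ s, d s ≠ 0) ∧
        ∀ b c, ¬ (PX' b ∧ PY' c) → ∑ s, d s * v s b * w s c = 0) :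
    ∃ (u : Fin (r * r') → ι × ι' → K[X]) (v : Fin (r * r') → κ × κ' → K[X])
      (w : Fin (r * r') → μ × μ' → K[X]) (d : Fin (r * r') → K[X]),
      IsApproxDecomposition (h + h') (kroneckerTensor t t') u v w ∧ (∀ s, d s ≠ 0) ∧
        ∀ b c, ¬ ((PX b.1 ∧ PX' b.2) ∧ (PY c.1 ∧ PY' c.2)) → ∑ s, d s * v s b * w s c = 0 := by
  obtain ⟨u, v, w, d, huvw, hd, hF⟩ := H
  obtain ⟨u', v', w', d', huvw', hd', hF'⟩ := H'
  refine ⟨_, _, _, fun ρ => d (finProdFinEquiv.symm ρ).1 * d' (finProdFinEquiv.symm ρ).2,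
    huvw.kronecker huvw', fun s => mul_ne_zero (hd _) (hd' _), fun b c hbc => ?_⟩
  have key := weightSum_kronecker d v w d' v' w' b c
  beta_reduce
  rw [key]
  by_cases h1 : PX b.1 ∧ PY c.1
  · have h2 : ¬ (PX' b.2 ∧ PY' c.2) := fun h2 => hbc ⟨⟨h1.1, h2.1⟩, h1.2, h2.2⟩
    rw [hF' b.2 c.2 h2, mul_zero]
  · rw [hF b.1 c.1 h1, zero_mul]

/-- **Isolated anchors restrict**: composing with index maps `f, g, e` (tree
`IsApproxDecomposition.precomp`) keeps the weights, and the weight form vanishes off any predicates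
`A'_X ⊇ g⁻¹(A_X)`, `A'_Y ⊇ e⁻¹(A_Y)`. [cite: Stothers2010, §1, Def. 8] -/
theorem isolated_precomp {ι κ μ ι' κ' μ' : Type*} {h r : ℕ} {t : ι → κ → μ → K} {PX : κ → Prop}
    {PY : μ → Prop}
    (H : ∃ (u : Fin r → ι → K[X]) (v : Fin r → κ → K[X]) (w : Fin r → μ → K[X]) (d : Fin r → K[X]),
      IsApproxDecomposition h t u v w ∧ (∀ s, d s ≠ 0) ∧
        ∀ b c, ¬ (PX b ∧ PY c) → ∑ s, d s * v s b * w s c = 0)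
    (f : ι' → ι) (g : κ' → κ) (e : μ' → μ) {PX' : κ' → Prop} {PY' : μ' → Prop}
    (hg : ∀ b', PX (g b') → PX' b') (he : ∀ c', PY (e c') → PY' c') :
    ∃ (u : Fin r → ι' → K[X]) (v : Fin r → κ' → K[X]) (w : Fin r → μ' → K[X]) (d : Fin r → K[X]),
      IsApproxDecomposition h (fun a b c => t (f a) (g b) (e c)) u v w ∧ (∀ s, d s ≠ 0) ∧
        ∀ b c, ¬ (PX' b ∧ PY' c) → ∑ s, d s * v s b * w s c = 0 := by
  obtain ⟨u, v, w, d, huvw, hd, hF⟩ := H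
  exact ⟨_, _, _, d, huvw.precomp f g e, hd,
    fun b c hbc => hF (g b) (e c) fun h => hbc ⟨hg b h.1, he c h.2⟩⟩

/-! ## §2 Knuth's Ex. 67(g) with the structure of its output -/

/-- **Knuth, TAOCP 2, §4.6.4, Ex. 67(g) — structured form** (Stothers 2010, Thm. 8; Pan 1984,
Prop. 16.2).  From an approximate realization `(w_s,u_s,v_s)_{s<r}` of `t` of order `d₀` with non-zero
weights `d_s` and `∑_s d_s u_s(b) v_s(c) = 0` for ALL `b, c`, and `q + |κ| + |μ| ≤ r`: an approximate
realization of `t ⊕ ⟨1,q,1⟩` (tree `innerAugment t q`) with `r` triads whose weight form for the SAME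
weights vanishes at every pair of inputs not both new — the new block `⟨1,q,1⟩` is an ISOLATED ANCHOR
(Knuth's answer to 67(g): `(ε^{d₀+e+2} w_s ⊕ d_s) ⊗ (u_s ⊕ ε^{d₀+1} f v_{·s}) ⊗ (v_s ⊕ ε^{d₀+1} g w_{·s}/p)`;
the mixed weight sums are `ε^{d₀+1}∑_s d_s u_s(b) Y_j(s) = 0` and `ε^{d₀+1}∑_s d_s X_i(s) v_s(c) = 0` by the
hint's biorthogonality). [cite: KnuthTAOCP2, §4.6.4, Ex. 67(g)] [cite: Stothers2010, §1, Thm. 8]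
[cite: Pan1984, Prop. 16.2] -/
theorem isolated_innerAugment {ι κ μ : Type*} [Fintype ι] [Fintype κ] [Fintype μ] [DecidableEq ι]
    [DecidableEq κ] [DecidableEq μ] {t : ι → κ → μ → K} {d₀ r : ℕ}
    {w : Fin r → ι → K[X]} {u : Fin r → κ → K[X]} {v : Fin r → μ → K[X]}
    (hreal : IsApproxDecomposition d₀ t w u v) (d : Fin r → K[X]) (hd : ∀ s, d s ≠ 0)
    (himp : ∀ b c, ∑ s, d s * u s b * v s c = 0) {q : ℕ}
    (hq : q + Fintype.card κ + Fintype.card μ ≤ r) :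
    ∃ (H : ℕ) (W' : Fin r → ι ⊕ Unit → K[X]) (U' : Fin r → κ ⊕ Fin q → K[X])
      (V' : Fin r → μ ⊕ Fin q → K[X]), IsApproxDecomposition H (innerAugment t q) W' U' V' ∧
        ∀ b' c', ¬ (b'.isRight ∧ c'.isRight) → ∑ s, d s * U' s b' * V' s c' = 0 := by
  classical
  have hφi : Function.Injective (algebraMap K[X] (RatFunc K)) := RatFunc.algebraMap_injective K
  -- Knuth's hint over the field `K(ε)`
  have hq' : q + Fintype.card κ + Fintype.card μ ≤ Fintype.card (Fin r) := by simpa using hq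
  obtain ⟨x, z, hx, hz, hxz⟩ := exists_biorthogonal_family (K := RatFunc K) (S := Fin r)
    (fun b s => algebraMap K[X] (RatFunc K) (u s b))
    (fun c s => algebraMap K[X] (RatFunc K) (d s * v s c)) hq'
  -- clear denominators
  obtain ⟨Q, hQ0, hQ⟩ := exists_polynomial_mul_eq_algebraMap (fun p : Fin q × Fin r => x p.1 p.2)
  choose Xp hXp using fun i s => hQ (i, s)
  obtain ⟨Q₁, hQ₁0, hQ₁⟩ := exists_polynomial_mul_eq_algebraMap (fun p : Fin q × Fin r => z p.1 p.2)
  choose Zp hZp using fun j s => hQ₁ (j, s)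
  dsimp only at hXp hZp
  set Dall : K[X] := ∏ s, d s with hDall
  have hDall0 : Dall ≠ 0 := Finset.prod_ne_zero_iff.2 fun s _ => hd s
  set Yp : Fin q → Fin r → K[X] := fun j s => Zp j s * ∏ s' ∈ Finset.univ.erase s, d s' with hYp
  have hdYp : ∀ j s, algebraMap K[X] (RatFunc K) (d s * Yp j s) =
      algebraMap K[X] (RatFunc K) (Q₁ * Dall) * z j s := by
    intro j s
    have hprod : d s * ∏ s' ∈ Finset.univ.erase s, d s' = Dall := by
      rw [hDall, Finset.mul_prod_erase _ _ (Finset.mem_univ s)]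
    calc algebraMap K[X] (RatFunc K) (d s * Yp j s)
        = algebraMap K[X] (RatFunc K) (Zp j s) *
            algebraMap K[X] (RatFunc K) (d s * ∏ s' ∈ Finset.univ.erase s, d s') := by
          rw [hYp]; simp only [map_mul]; ring
      _ = algebraMap K[X] (RatFunc K) (Q₁ * Dall) * z j s := by rw [hprod, ← hZp, map_mul]; ring
  -- the three polynomial identities
  have hP1 : ∀ i c, ∑ s, d s * Xp i s * v s c = 0 := by
    intro i c
    apply hφi
    rw [map_sum, map_zero]
    have h := hx i c
    unfold dotProduct at h
    calc ∑ s, algebraMap K[X] (RatFunc K) (d s * Xp i s * v s c)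
        = algebraMap K[X] (RatFunc K) Q * ∑ s, x i s * algebraMap K[X] (RatFunc K) (d s * v s c) := by
          rw [Finset.mul_sum]
          refine Finset.sum_congr rfl fun s _ => ?_
          have := hXp i s
          simp only [map_mul] at this ⊢
          rw [← this]; ring
      _ = 0 := by rw [h, mul_zero]
  have hP2 : ∀ j b, ∑ s, d s * u s b * Yp j s = 0 := by
    intro j b
    apply hφi
    rw [map_sum, map_zero]
    have h := hz j b
    unfold dotProduct at h
    calc ∑ s, algebraMap K[X] (RatFunc K) (d s * u s b * Yp j s)
        = algebraMap K[X] (RatFunc K) (Q₁ * Dall) * ∑ s, algebraMap K[X] (RatFunc K) (u s b) * z j s := by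
          rw [Finset.mul_sum]
          refine Finset.sum_congr rfl fun s _ => ?_
          have := hdYp j s
          rw [show d s * u s b * Yp j s = u s b * (d s * Yp j s) by ring, map_mul, this]
          ring
      _ = 0 := by rw [h, mul_zero]
  have hP3 : ∀ i j, ∑ s, d s * Xp i s * Yp j s = if i = j then Q * (Q₁ * Dall) else 0 := by
    intro i j
    apply hφi
    rw [map_sum]
    have h := hxz i j
    unfold dotProduct at h
    calc ∑ s, algebraMap K[X] (RatFunc K) (d s * Xp i s * Yp j s)
        = algebraMap K[X] (RatFunc K) Q * algebraMap K[X] (RatFunc K) (Q₁ * Dall) *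
            ∑ s, x i s * z j s := by
          rw [Finset.mul_sum]
          refine Finset.sum_congr rfl fun s _ => ?_
          have h1 := hXp i s
          have h2 := hdYp j s
          rw [show d s * Xp i s * Yp j s = Xp i s * (d s * Yp j s) by ring, map_mul, h2, ← h1]
          ring
      _ = algebraMap K[X] (RatFunc K) (if i = j then Q * (Q₁ * Dall) else 0) := by
          rw [h]
          split_ifs <;> simp [map_mul]
  -- `Q Q₁ D = X^e R`, `R(0) = p ≠ 0`; normalise `p` to `1`
  obtain ⟨e, R, hQR, hR0⟩ := exists_eq_X_pow_mul_coeff_zero_ne_zero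
    (mul_ne_zero hQ0 (mul_ne_zero hQ₁0 hDall0) : Q * (Q₁ * Dall) ≠ 0)
  set p := R.coeff 0 with hp
  set Xq : Fin q → Fin r → K[X] := fun i s => C p⁻¹ * Xp i s with hXq
  have hQ1 : ∀ i c, ∑ s, d s * Xq i s * v s c = 0 := by
    intro i c
    rw [← mul_zero (C p⁻¹), ← hP1 i c, Finset.mul_sum]
    exact Finset.sum_congr rfl fun s _ => by rw [hXq]; ring
  have hQ3 : ∀ i j, ∑ s, d s * Xq i s * Yp j s = if i = j then X ^ e * (C p⁻¹ * R) else 0 := by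
    intro i j
    have h : ∑ s, d s * Xq i s * Yp j s = C p⁻¹ * ∑ s, d s * Xp i s * Yp j s := by
      rw [Finset.mul_sum]
      exact Finset.sum_congr rfl fun s _ => by rw [hXq]; ring
    rw [h, hP3, hQR]
    split_ifs <;> ring
  have hR1 : (C p⁻¹ * R).coeff 0 = 1 := by
    rw [coeff_C_mul, ← hp, inv_mul_cancel₀ hR0]
  -- the approximate decomposition of order `N + d₀ = 2 d₀ + e + 2`
  set A := d₀ + 1 with hA
  set N := d₀ + e + 2 with hN
  set W' : Fin r → ι ⊕ Unit → K[X] := fun s => Sum.elim (fun a => X ^ N * w s a) (fun _ => d s)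
    with hW'
  set U' : Fin r → κ ⊕ Fin q → K[X] := fun s => Sum.elim (fun b => u s b) (fun i => X ^ A * Xq i s)
    with hU'
  set V' : Fin r → μ ⊕ Fin q → K[X] := fun s => Sum.elim (fun c => v s c) (fun j => X ^ A * Yp j s)
    with hV'
  refine ⟨N + d₀, W', U', V', ?_, ?_⟩
  · intro a' b' c' j hj
    rcases a' with a | a <;> rcases b' with b | i <;> rcases c' with c | j'
    · -- `(a,b,c)`: `X^N · ∑ w u v`
      have hs : (∑ s, W' s (Sum.inl a) * U' s (Sum.inl b) * V' s (Sum.inl c)) =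
          X ^ N * ∑ s, w s a * u s b * v s c := by
        rw [Finset.mul_sum]
        exact Finset.sum_congr rfl fun s _ => by simp only [hW', hU', hV', Sum.elim_inl]; ring
      rw [hs, coeff_X_pow_mul']
      by_cases hNj : N ≤ j
      · rw [if_pos hNj, hreal a b c (j - N) (by omega)]
        by_cases hjH : j = N + d₀
        · rw [if_pos (by omega : j - N = d₀), if_pos hjH]; rfl
        · rw [if_neg (by omega : j - N ≠ d₀), if_neg hjH]
      · rw [if_neg hNj, if_neg (by omega)]
    · -- `(a,b,j')`: order `≥ N + A > N + d₀`
      have hs : (∑ s, W' s (Sum.inl a) * U' s (Sum.inl b) * V' s (Sum.inr j')) =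
          X ^ (N + A) * ∑ s, w s a * u s b * Yp j' s := by
        rw [Finset.mul_sum]
        exact Finset.sum_congr rfl fun s _ => by
          simp only [hW', hU', hV', Sum.elim_inl, Sum.elim_inr]; ring
      rw [hs, coeff_X_pow_mul', if_neg (by omega)]
      simp [innerAugment]
    · -- `(a,i,c)`
      have hs : (∑ s, W' s (Sum.inl a) * U' s (Sum.inr i) * V' s (Sum.inl c)) =
          X ^ (N + A) * ∑ s, w s a * Xq i s * v s c := by
        rw [Finset.mul_sum]
        exact Finset.sum_congr rfl fun s _ => by
          simp only [hW', hU', hV', Sum.elim_inl, Sum.elim_inr]; ring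
      rw [hs, coeff_X_pow_mul', if_neg (by omega)]
      simp [innerAugment]
    · -- `(a,i,j')`
      have hs : (∑ s, W' s (Sum.inl a) * U' s (Sum.inr i) * V' s (Sum.inr j')) =
          X ^ (N + A + A) * ∑ s, w s a * Xq i s * Yp j' s := by
        rw [Finset.mul_sum]
        exact Finset.sum_congr rfl fun s _ => by
          simp only [hW', hU', hV', Sum.elim_inl, Sum.elim_inr]; ring
      rw [hs, coeff_X_pow_mul', if_neg (by omega)]
      simp [innerAugment]
    · -- `(•,b,c)`: improvability
      have hs : (∑ s, W' s (Sum.inr a) * U' s (Sum.inl b) * V' s (Sum.inl c)) =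
          ∑ s, d s * u s b * v s c :=
        Finset.sum_congr rfl fun s _ => by simp only [hW', hU', hV', Sum.elim_inl, Sum.elim_inr]
      rw [hs, himp b c, coeff_zero]
      simp [innerAugment]
    · -- `(•,b,j')`: `X^A ∑ d u Yp = 0`
      have hs : (∑ s, W' s (Sum.inr a) * U' s (Sum.inl b) * V' s (Sum.inr j')) =
          X ^ A * ∑ s, d s * u s b * Yp j' s := by
        rw [Finset.mul_sum]
        exact Finset.sum_congr rfl fun s _ => by
          simp only [hW', hU', hV', Sum.elim_inl, Sum.elim_inr]; ring
      rw [hs, hP2 j' b, mul_zero, coeff_zero]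
      simp [innerAugment]
    · -- `(•,i,c)`: `X^A ∑ d Xq v = 0`
      have hs : (∑ s, W' s (Sum.inr a) * U' s (Sum.inr i) * V' s (Sum.inl c)) =
          X ^ A * ∑ s, d s * Xq i s * v s c := by
        rw [Finset.mul_sum]
        exact Finset.sum_congr rfl fun s _ => by
          simp only [hW', hU', hV', Sum.elim_inl, Sum.elim_inr]; ring
      rw [hs, hQ1 i c, mul_zero, coeff_zero]
      simp [innerAugment]
    · -- `(•,i,j')`: `X^{2A} ∑ d Xq Yp = X^{2A+e} R₁ δ`
      have hs : (∑ s, W' s (Sum.inr a) * U' s (Sum.inr i) * V' s (Sum.inr j')) =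
          X ^ (A + A) * ∑ s, d s * Xq i s * Yp j' s := by
        rw [Finset.mul_sum]
        exact Finset.sum_congr rfl fun s _ => by
          simp only [hW', hU', hV', Sum.elim_inr]; ring
      rw [hs, hQ3 i j']
      by_cases hij : i = j'
      · subst hij
        rw [if_pos rfl, show X ^ (A + A) * (X ^ e * (C p⁻¹ * R)) = X ^ (A + A + e) * (C p⁻¹ * R) by ring,
          coeff_X_pow_mul']
        by_cases hjH : j = N + d₀
        · rw [if_pos (by omega), if_pos hjH, show j - (A + A + e) = 0 by omega, hR1]
          simp [innerAugment]
        · rw [if_neg (by omega), if_neg hjH]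
      · rw [if_neg hij, mul_zero, coeff_zero]
        simp [innerAugment, hij]
  · -- the ISOLATED-ANCHOR structure of the output: same weights `d`
    intro b' c' hbc
    rcases b' with b | i <;> rcases c' with c | j'
    · have hs : (∑ s, d s * U' s (Sum.inl b) * V' s (Sum.inl c)) = ∑ s, d s * u s b * v s c :=
        Finset.sum_congr rfl fun s _ => by simp only [hU', hV', Sum.elim_inl]
      rw [hs, himp b c]
    · have hs : (∑ s, d s * U' s (Sum.inl b) * V' s (Sum.inr j')) =
          X ^ A * ∑ s, d s * u s b * Yp j' s := by
        rw [Finset.mul_sum]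
        exact Finset.sum_congr rfl fun s _ => by
          simp only [hU', hV', Sum.elim_inl, Sum.elim_inr]; ring
      rw [hs, hP2 j' b, mul_zero]
    · have hs : (∑ s, d s * U' s (Sum.inr i) * V' s (Sum.inl c)) =
          X ^ A * ∑ s, d s * Xq i s * v s c := by
        rw [Finset.mul_sum]
        exact Finset.sum_congr rfl fun s _ => by
          simp only [hU', hV', Sum.elim_inl, Sum.elim_inr]; ring
      rw [hs, hQ1 i c, mul_zero]
    · exact absurd ⟨rfl, rfl⟩ hbc

/-! ## §3 Re-anchoring a direct sum of matrix products -/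

/-- The index map of the `X`-slot of `matMulDirectSum_cons_inner` sends exactly block `0` to the new
`X`-inputs. [cite: KnuthTAOCP2, §4.6.4, Ex. 67(c)] -/
theorem consSnd_isRight {p : ℕ} (k m : Fin p → ℕ) (q : ℕ)
    (b : Σ i : Fin (p + 1), Fin ((Fin.cons 1 k : Fin (p + 1) → ℕ) i) ×
      Fin ((Fin.cons q m : Fin (p + 1) → ℕ) i)) (h : (consSnd k m q b).isRight) : b.1 = 0 := by
  rcases b with ⟨⟨_ | j, hj⟩, b⟩
  · rfl
  · simp [consSnd] at h

/-- The index map of the `Y`-slot of `matMulDirectSum_cons_inner` sends exactly block `0` to the new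
`Y`-inputs. [cite: KnuthTAOCP2, §4.6.4, Ex. 67(c)] -/
theorem consThd_isRight {p : ℕ} (m n : Fin p → ℕ) (q : ℕ)
    (c : Σ i : Fin (p + 1), Fin ((Fin.cons q m : Fin (p + 1) → ℕ) i) ×
      Fin ((Fin.cons 1 n : Fin (p + 1) → ℕ) i)) (h : (consThd m n q c).isRight) : c.1 = 0 := by
  rcases c with ⟨⟨_ | j, hj⟩, c⟩
  · rfl
  · simp [consThd] at h

/-- **RE-ANCHORING** (Knuth 67(g)/(h); Stothers Thm. 8; Pan Prop. 16.2, direct-sum format): an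
improvable approximate realization of `⊕ᵢ⟨kᵢ,mᵢ,nᵢ⟩` of length `r` (non-zero weights `d_s`, weight form
`≡ 0`) and `q + ∑ᵢkᵢmᵢ + ∑ᵢmᵢnᵢ ≤ r` give an approximate realization of `⟨1,q,1⟩ ⊕ ⊕ᵢ⟨kᵢ,mᵢ,nᵢ⟩`
(`matMulDirectSum K (cons 1 k) (cons q m) (cons 1 n)`) of length `r` in which the anchor block `0` is
ISOLATED: non-zero weights whose form vanishes unless both inputs lie in block `0`.
[cite: KnuthTAOCP2, §4.6.4, Ex. 67(g)] [cite: Stothers2010, §1, Thm. 8] [cite: Pan1984, Prop. 16.2] -/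
theorem isolated_reanchor {p : ℕ} (k m n : Fin p → ℕ) {d₀ r : ℕ}
    {w : Fin r → (Σ i, Fin (k i) × Fin (n i)) → K[X]} {u : Fin r → (Σ i, Fin (k i) × Fin (m i)) → K[X]}
    {v : Fin r → (Σ i, Fin (m i) × Fin (n i)) → K[X]}
    (hreal : IsApproxDecomposition d₀ (matMulDirectSum K k m n) w u v) (d : Fin r → K[X])
    (hd : ∀ s, d s ≠ 0) (himp : ∀ b c, ∑ s, d s * u s b * v s c = 0) {q : ℕ}
    (hq : q + ∑ i, k i * m i + ∑ i, m i * n i ≤ r) :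
    ∃ (H : ℕ) (W : Fin r → _ → K[X]) (U : Fin r → _ → K[X]) (V : Fin r → _ → K[X]) (D : Fin r → K[X]),
      IsApproxDecomposition H (matMulDirectSum K (Fin.cons 1 k) (Fin.cons q m) (Fin.cons 1 n)) W U V ∧
        (∀ s, D s ≠ 0) ∧ ∀ b c, ¬ (b.1 = 0 ∧ c.1 = 0) → ∑ s, D s * U s b * V s c = 0 := by
  classical
  have hX : Fintype.card (Σ i, Fin (k i) × Fin (m i)) = ∑ i, k i * m i := by
    simp [Fintype.card_prod]
  have hY : Fintype.card (Σ i, Fin (m i) × Fin (n i)) = ∑ i, m i * n i := by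
    simp [Fintype.card_prod]
  obtain ⟨H, W', U', V', hdec, hiso⟩ := isolated_innerAugment hreal d hd himp (q := q)
    (by rw [hX, hY]; omega)
  have h1 : ∃ (u : Fin r → _ → K[X]) (v : Fin r → _ → K[X]) (w : Fin r → _ → K[X]) (d : Fin r → K[X]),
      IsApproxDecomposition H (innerAugment (matMulDirectSum K k m n) q) u v w ∧ (∀ s, d s ≠ 0) ∧
        ∀ b c, ¬ ((b.isRight : Prop) ∧ (c.isRight : Prop)) → ∑ s, d s * v s b * w s c = 0 :=
    ⟨W', U', V', d, hdec, hd, hiso⟩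
  obtain ⟨W, U, V, D, hWUV, hD, hF⟩ := isolated_precomp h1 (consFst k n) (consSnd k m q) (consThd m n q)
    (PX' := fun b => b.1 = 0) (PY' := fun c => c.1 = 0) (consSnd_isRight k m q) (consThd_isRight m n q)
  refine ⟨H, W, U, V, D, ?_, hD, hF⟩
  rw [matMulDirectSum_cons_inner]
  exact hWUV

end Summit.MatrixMultiplication.MatrixMultiplication.Theorems.FarEdgeDescentIsolatedStep

end
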